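import Mathlib
import Summits.Ventures.PercRepro2.MixChordOInactive
import Summits.Ventures.PercRepro2.MixChordLaw

/-!
# The `o`-class `D`-chord is exactly two q-free closed-world rows (blind cell PercRepro2, night-1 g20;
proofs/NIGHT1-G20.md §3′)

Along a root edge `f = {o, a₁}` (any `a₃`), with the closed child `p₀ = p[f ↦ 0]` and the open child
`p₁ = p[f ↦ 1]` (`o ∈ C₁` surely there: `Gc p₁ = 0`, `Do = D`, `E_Q[σ_o] = Z`, …), the cleared deficit
of the `D`-chord `(1 − q)·Gc(p₀)·D(p) ≤ Gc(p)·D(p₀)` is `q(1 − q)` times an AFFINE function of `q`: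

**`oRows_identity`**: `(Gc p · D₀ − (1 − q) · Gc p₀ · D(p)) · (Z₀ Z₁ D₀) = q(1 − q)·[(1 − q)·oRow0 + q·Z₁·oRow1]`,

where `oRow0`, `oRow1` are explicit polynomials in the pattern masses of `p₀` and `p₁` (the cleared
forms of `ROW₀`, `ROW₁` of NIGHT1-G20.md §3′: in conditional language `m = P⁰(·|Q)`, `h = m(oH)`,
`d⁰ = m(PD)`, `κ = D₁/Z₀`, `γ⁰ = m(oU|PD)`, `C = Cov(σ_b, σ₃)`, `Δ = E_{m¹} − E_m`,
`ROW₀ = (1 − γ⁰)[κC⁰ − (1 − h)d⁰C¹ − κd⁰Δ1_{bU}] + (1 − h)d⁰Δσ_b[ΔK − (1 − γ⁰)Δσ₃] − hd⁰Γ⁰`,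
`ROW₁ = (1 − h)(1 − γ⁰)[κC⁰ − (1 − h)d⁰C¹ − κd⁰Δ1_{bU}] + (1 − h)κΔσ_bΔK − hκΓ⁰`,
`oRow0 = Z₀⁴ Z₁ D₀² · ROW₀`, `oRow1 = Z₀⁴ D₀² · ROW₁`).  The abstract identity is `o_rows_key` (`ring`);
the instance needs only the `o`-coincidence of the open child (`prob_inter_conn_eq`, `prob_inter_conn₂_eq_zero`).
Hence **`nMixChord_D_of_oRows`**: `oRow0 ≥ 0 → oRow1 ≥ 0 → NMixChord normD … f` (the `D`-chord along
the `o`-edge at EVERY weight of `f` from two q-FREE rows about the instance WITHOUT the edge), and the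
converse **`oRows_comb_of_nMixChord_D`** at the given weight.  In the `a₃`-inactive case both rows are
the single row of MixChordOInactiveD.lean (one conditional BHK); with `a₃` active both rows are
census-true (140 / 140) and open.

Own code; standard axioms.
-/

namespace Summit.Ventures.PercRepro2

open UnionCluster CovForm

namespace Mix

section Key

variable {R : Type*} [CommRing R]

/-- The abstract two-rows identity (the slots are the pattern masses of the closed child `·0` and
of the open child `·1`, the latter already reduced by the `o`-coincidence). -/
lemma o_rows_key (q Z0 D0 Do0 Sb0 S30 So0 S3o0 Sbo0 Sb30 Sb3o0 PDb0 PDbo0 Z1 D1 Sb1 S31 Sb31 PDb1 : R) :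
    ((((1 - q) * Z0 + q * Z1) * (((1 - q) * D0 + q * D1) * ((1 - q) * Sbo0 + q * Sb1) + ((1 - q) * Do0 + q * D1) * ((1 - q) * Sb30 + q * Sb31) - ((1 - q) * D0 + q * D1) * ((1 - q) * Sb3o0 + q * Sb31)) + (-((1 - q) * Sb0 + q * Sb1)) * (((1 - q) * D0 + q * D1) * ((1 - q) * So0 + q * Z1) + ((1 - q) * Do0 + q * D1) * ((1 - q) * S30 + q * S31) - ((1 - q) * D0 + q * D1) * ((1 - q) * S3o0 + q * S31)) + ((1 - q) * Z0 + q * Z1) * (((1 - q) * Do0 + q * D1) * ((1 - q) * PDb0 + q * PDb1) - ((1 - q) * D0 + q * D1) * ((1 - q) * PDbo0 + q * PDb1))) * D0 - (1 - q) * (Z0 * (D0 * Sbo0 + Do0 * Sb30 - D0 * Sb3o0) + (-Sb0) * (D0 * So0 + Do0 * S30 - D0 * S3o0) + Z0 * (Do0 * PDb0 - D0 * PDbo0)) * ((1 - q) * D0 + q * D1)) * (Z0 * Z1 * D0) =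
      q * (1 - q) * ((1 - q) * (Z0 * (D0 - Do0) * (D1 * (Z0 * Sb30 - Sb0 * S30) * Z1 * D0 - Z0 * D0 ^ 2 * (Z1 * Sb31 - Sb1 * S31) - Z0 * Z1 * D0 * (PDb1 * D0 - PDb0 * D1)) + Z1 * D0 ^ 3 * (Sb1 * Z0 - Sb0 * Z1) * (Z0 - (So0 + S30 - S3o0)) - D0 ^ 2 * (D0 - Do0) * (Sb1 * Z0 - Sb0 * Z1) * (S31 * Z0 - S30 * Z1) - (Z0 - Z1) * Z1 * D0 ^ 2 * (D0 * (Z0 * (Sbo0 - Sb3o0) - Sb0 * (So0 - S3o0)) + Do0 * (Z0 * Sb30 - Sb0 * S30) - Z0 * (D0 * PDbo0 - PDb0 * Do0))) + q * (Z1 * ((D0 - Do0) * (D1 * (Z0 * Sb30 - Sb0 * S30) * Z1 * D0 - Z0 * D0 ^ 2 * (Z1 * Sb31 - Sb1 * S31) - Z0 * Z1 * D0 * (PDb1 * D0 - PDb0 * D1)) + D0 ^ 2 * D1 * (Sb1 * Z0 - Sb0 * Z1) * (Z0 - (So0 + S30 - S3o0)) - (Z0 - Z1) * D0 * D1 * (D0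 * (Z0 * (Sbo0 - Sb3o0) - Sb0 * (So0 - S3o0)) + Do0 * (Z0 * Sb30 - Sb0 * S30) - Z0 * (D0 * PDbo0 - PDb0 * Do0))))) := by
  ring

end Key

section Rows

variable {V : Type*} {E : Type*} [Fintype E] [DecidableEq E] [DecidableEq V] {R : Type*}
  [Field R] [LinearOrder R]

variable (p₀ p₁ : E → R) (ends : E → Sym2 V) (o a₁ a₂ a₃ b : V)

/-- **`oRow0`** — the cleared first row (`q → 0`) of the `o`-class `D`-chord, a polynomial in the
pattern masses of the closed child `p₀` and the open child `p₁`. -/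
noncomputable def oRow0 : R :=
  (prob p₀ (avoidAll ends a₂ {a₁})) * ((prob p₀ (PDEvent ends a₁ a₂ a₃)) - (Do p₀ ends o a₁ a₂ a₃)) * ((prob p₁ (PDEvent ends a₁ a₂ a₃)) * ((prob p₀ (avoidAll ends a₂ {a₁})) * (EQb3 p₀ ends a₁ a₂ a₃ b) - ((-gap p₀ ends a₁ a₂ b)) * (EQ3 p₀ ends a₁ a₂ a₃)) * (prob p₁ (avoidAll ends a₂ {a₁})) * (prob p₀ (PDEvent ends a₁ a₂ a₃)) - (prob p₀ (avoidAll ends a₂ {a₁})) * (prob p₀ (PDEvent ends a₁ a₂ a₃)) ^ 2 * ((prob p₁ (avoidAll ends a₂ {a₁})) * (EQb3 p₁ ends a₁ a₂ a₃ b) - ((-gap p₁ ends a₁ a₂ b)) * (EQ3 p₁ ends a₁ a₂ a₃)) - (prob p₀ (avoidAll ends a₂ {a₁})) * (prob p₁ (avoidAll ends a₂ {a₁})) * (prob p₀ (PDEvent ends a₁ a₂ a₃)) * ((PDb p₁ ends a₁ a₂ a₃ b) * (prob p₀ (PDEvent ends a₁ a₂ a₃)) - (PDb p₀ ends a₁ a₂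 a₃ b) * (prob p₁ (PDEvent ends a₁ a₂ a₃)))) + (prob p₁ (avoidAll ends a₂ {a₁})) * (prob p₀ (PDEvent ends a₁ a₂ a₃)) ^ 3 * (((-gap p₁ ends a₁ a₂ b)) * (prob p₀ (avoidAll ends a₂ {a₁})) - ((-gap p₀ ends a₁ a₂ b)) * (prob p₁ (avoidAll ends a₂ {a₁}))) * ((prob p₀ (avoidAll ends a₂ {a₁})) - ((EQo p₀ ends o a₁ a₂) + (EQ3 p₀ ends a₁ a₂ a₃) - (EQ3o p₀ ends o a₁ a₂ a₃))) - (prob p₀ (PDEvent ends a₁ a₂ a₃)) ^ 2 * ((prob p₀ (PDEvent ends a₁ a₂ a₃)) - (Do p₀ ends o a₁ a₂ a₃)) * (((-gap p₁ ends a₁ a₂ b)) * (prob p₀ (avoidAll ends a₂ {a₁})) - ((-gap p₀ ends a₁ a₂ b)) * (prob p₁ (avoidAll ends a₂ {a₁}))) * ((EQ3 p₁ ends a₁ a₂ a₃) * (prob p₀ (avoidAll ends a₂ {a₁})) - (EQ3 p₀ ends a₁ a₂ a₃) * (prob p₁ (avoidAll ends a₂ {a₁}))) - ((prob p₀ (avoidAll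 ends a₂ {a₁})) - (prob p₁ (avoidAll ends a₂ {a₁}))) * (prob p₁ (avoidAll ends a₂ {a₁})) * (prob p₀ (PDEvent ends a₁ a₂ a₃)) ^ 2 * ((prob p₀ (PDEvent ends a₁ a₂ a₃)) * ((prob p₀ (avoidAll ends a₂ {a₁})) * ((EQbo p₀ ends o a₁ a₂ b) - (EQb3o p₀ ends o a₁ a₂ a₃ b)) - ((-gap p₀ ends a₁ a₂ b)) * ((EQo p₀ ends o a₁ a₂) - (EQ3o p₀ ends o a₁ a₂ a₃))) + (Do p₀ ends o a₁ a₂ a₃) * ((prob p₀ (avoidAll ends a₂ {a₁})) * (EQb3 p₀ ends a₁ a₂ a₃ b) - ((-gap p₀ ends a₁ a₂ b)) * (EQ3 p₀ ends a₁ a₂ a₃)) - (prob p₀ (avoidAll ends a₂ {a₁})) * ((prob p₀ (PDEvent ends a₁ a₂ a₃)) * (PDbo p₀ ends o a₁ a₂ a₃ b) - (PDb p₀ ends a₁ a₂ a₃ b) * (Do p₀ ends o a₁ a₂ a₃)))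

/-- **`oRow1`** — the cleared second row (`q → 1`). -/
noncomputable def oRow1 : R :=
  ((prob p₀ (PDEvent ends a₁ a₂ a₃)) - (Do p₀ ends o a₁ a₂ a₃)) * ((prob p₁ (PDEvent ends a₁ a₂ a₃)) * ((prob p₀ (avoidAll ends a₂ {a₁})) * (EQb3 p₀ ends a₁ a₂ a₃ b) - ((-gap p₀ ends a₁ a₂ b)) * (EQ3 p₀ ends a₁ a₂ a₃)) * (prob p₁ (avoidAll ends a₂ {a₁})) * (prob p₀ (PDEvent ends a₁ a₂ a₃)) - (prob p₀ (avoidAll ends a₂ {a₁})) * (prob p₀ (PDEvent ends a₁ a₂ a₃)) ^ 2 * ((prob p₁ (avoidAll ends a₂ {a₁})) * (EQb3 p₁ ends a₁ a₂ a₃ b) - ((-gap p₁ ends a₁ a₂ b)) * (EQ3 p₁ ends a₁ a₂ a₃)) - (prob p₀ (avoidAll ends a₂ {a₁})) * (prob p₁ (avoidAll ends a₂ {a₁})) * (prob p₀ (PDEvent ends a₁ a₂ a₃)) * ((PDb p₁ ends a₁ a₂ a₃ b) * (prob p₀ (PDEvent ends a₁ a₂ a₃)) - (PDb p₀ ends a₁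 a₂ a₃ b) * (prob p₁ (PDEvent ends a₁ a₂ a₃)))) + (prob p₀ (PDEvent ends a₁ a₂ a₃)) ^ 2 * (prob p₁ (PDEvent ends a₁ a₂ a₃)) * (((-gap p₁ ends a₁ a₂ b)) * (prob p₀ (avoidAll ends a₂ {a₁})) - ((-gap p₀ ends a₁ a₂ b)) * (prob p₁ (avoidAll ends a₂ {a₁}))) * ((prob p₀ (avoidAll ends a₂ {a₁})) - ((EQo p₀ ends o a₁ a₂) + (EQ3 p₀ ends a₁ a₂ a₃) - (EQ3o p₀ ends o a₁ a₂ a₃))) - ((prob p₀ (avoidAll ends a₂ {a₁})) - (prob p₁ (avoidAll ends a₂ {a₁}))) * (prob p₀ (PDEvent ends a₁ a₂ a₃)) * (prob p₁ (PDEvent ends a₁ a₂ a₃)) * ((prob p₀ (PDEvent ends a₁ a₂ a₃)) * ((prob p₀ (avoidAll ends a₂ {a₁})) * ((EQbo p₀ ends o a₁ a₂ b) - (EQb3o p₀ ends o a₁ a₂ a₃ b)) - ((-gap p₀ ends a₁ a₂ b)) * ((EQo p₀ ends o a₁ a₂) - (EQ3o p₀ ends o a₁ a₂ a₃))) + (Do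 p₀ ends o a₁ a₂ a₃) * ((prob p₀ (avoidAll ends a₂ {a₁})) * (EQb3 p₀ ends a₁ a₂ a₃ b) - ((-gap p₀ ends a₁ a₂ b)) * (EQ3 p₀ ends a₁ a₂ a₃)) - (prob p₀ (avoidAll ends a₂ {a₁})) * ((prob p₀ (PDEvent ends a₁ a₂ a₃)) * (PDbo p₀ ends o a₁ a₂ a₃ b) - (PDb p₀ ends a₁ a₂ a₃ b) * (Do p₀ ends o a₁ a₂ a₃)))

end Rows

section Identity

variable {V : Type*} {E : Type*} [Fintype E] [DecidableEq E] [DecidableEq V] {R : Type*}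
  [Field R] [LinearOrder R] [IsStrictOrderedRing R]

variable (p : E → R) (ends : E → Sym2 V) {o a₁ a₂ a₃ : V} (b : V) {f : E}

omit [DecidableEq V] in
/-- **The two-rows identity along `f = {o, a₁}`.** -/
theorem oRows_identity (hf : ends f = s(o, a₁)) :
    (Gc p ends o a₁ a₂ a₃ b * prob (Function.update p f 0) (PDEvent ends a₁ a₂ a₃) -
        (1 - p f) * Gc (Function.update p f 0) ends o a₁ a₂ a₃ b * prob p (PDEvent ends a₁ a₂ a₃)) *
      (prob (Function.update p f 0) (avoidAll ends a₂ {a₁}) *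
        prob (Function.update p f 1) (avoidAll ends a₂ {a₁}) *
        prob (Function.update p f 0) (PDEvent ends a₁ a₂ a₃)) =
    p f * (1 - p f) *
      ((1 - p f) * oRow0 (Function.update p f 0) (Function.update p f 1) ends o a₁ a₂ a₃ b +
        p f * (prob (Function.update p f 1) (avoidAll ends a₂ {a₁}) *
          oRow1 (Function.update p f 0) (Function.update p f 1) ends o a₁ a₂ a₃ b)) := by
  have hc1 := conn_a1_o_of_update_one p ends hf
  have hPDs := Chord.PDEvent_subset_avoidAll ends a₁ a₂ a₃
  have hTs := TEvent_subset_Q ends a₁ a₂ a₃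
  have hT's := TEvent_swap_subset_Q ends a₁ a₂ a₃
  have hQs : avoidAll ends a₂ {a₁} ⊆ avoidAll ends a₂ {a₁} := le_rfl
  unfold oRow0 oRow1 Gc DEF EQbo EQb3 EQb3o EQo EQ3 EQ3o PDb PDbo Do
  rw [gap_eq_Q, gap_eq_Q, gap_eq_Q]
  -- the masses at `p` are mixtures of the children's
  simp only [prob_eq_pin p _ f]
  -- the open child: `o ↔ a₁` on its support
  simp only [prob_inter_conn_eq _ ends hc1, prob_inter_conn_eq' _ ends hc1,
    prob_inter_conn₂_eq_zero _ ends hc1 _ _ hQs, prob_inter_conn₂_eq_zero _ ends hc1 _ _ hPDs,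
    prob_inter_conn₂_eq_zero _ ends hc1 _ _ hTs, prob_inter_conn₂_eq_zero _ ends hc1 _ _ hT's,
    prob_inter_conn₂_eq_zero' _ ends hc1 _ hQs, prob_inter_conn₂_eq_zero' _ ends hc1 _ hPDs,
    prob_inter_conn₂_eq_zero' _ ends hc1 _ hTs, prob_inter_conn₂_eq_zero' _ ends hc1 _ hT's]
  ring

omit [DecidableEq V] in
/-- **The `D`-chord along `f = {o, a₁}` from the two q-free rows** (at every weight of `f`; the open
child's `Q`-mass positive — when it vanishes, `Gc (p[f ↦ 0]) = 0` and the chord is trivial). -/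
theorem nMixChord_D_of_oRows (hp : IsProbVec p) (hf : ends f = s(o, a₁))
    (hZ1 : 0 < prob (Function.update p f 1) (avoidAll ends a₂ {a₁}))
    (h0 : 0 ≤ oRow0 (Function.update p f 0) (Function.update p f 1) ends o a₁ a₂ a₃ b)
    (h1 : 0 ≤ oRow1 (Function.update p f 0) (Function.update p f 1) ends o a₁ a₂ a₃ b) :
    NMixChord (normD ends a₁ a₂ a₃) p ends o a₁ a₂ a₃ b f := by
  have hp0 : IsProbVec (Function.update p f 0) := hp.update f le_rfl zero_le_one
  have hq0 := hp.nonneg f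
  have hq1 := hp.le_one f
  have hG1 : Gc (Function.update p f 1) ends o a₁ a₂ a₃ b = 0 :=
    Gc_eq_zero_of_sure_conn_o _ ends o a₃ b (conn_a1_o_of_update_one p ends hf)
  have hid := oRows_identity p ends (a₂ := a₂) (a₃ := a₃) b hf
  have hD := EdmRow.prob_le_prob_update_zero_of_isLowerSet hp
    (EdmRow.isLowerSet_PDEvent ends a₁ a₂ a₃) f
  have hDn := prob_nonneg hp (PDEvent ends a₁ a₂ a₃)
  have hD0n := prob_nonneg hp0 (PDEvent ends a₁ a₂ a₃)
  have hZ0 : prob (Function.update p f 1) (avoidAll ends a₂ {a₁}) ≤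
      prob (Function.update p f 0) (avoidAll ends a₂ {a₁}) := by
    have hp1 : IsProbVec (Function.update p f 1) := hp.update f zero_le_one le_rfl
    have := EdmRow.prob_le_prob_update_zero_of_isLowerSet hp1
      (EdmRow.isLowerSet_avoidAll ends a₁ a₂) f
    rwa [Function.update_idem] at this
  unfold NMixChord normD
  rw [hG1, mul_zero, sub_zero]
  by_cases hD0 : prob (Function.update p f 0) (PDEvent ends a₁ a₂ a₃) = 0
  · have : prob p (PDEvent ends a₁ a₂ a₃) = 0 := le_antisymm (hD0 ▸ hD) hDn
    rw [this, hD0, mul_zero, mul_zero]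
  · have hD0pos : 0 < prob (Function.update p f 0) (PDEvent ends a₁ a₂ a₃) :=
      lt_of_le_of_ne hD0n (Ne.symm hD0)
    have hfac : 0 < prob (Function.update p f 0) (avoidAll ends a₂ {a₁}) *
        prob (Function.update p f 1) (avoidAll ends a₂ {a₁}) *
        prob (Function.update p f 0) (PDEvent ends a₁ a₂ a₃) :=
      mul_pos (mul_pos (lt_of_lt_of_le hZ1 hZ0) hZ1) hD0pos
    have hrhs : 0 ≤ p f * (1 - p f) *
        ((1 - p f) * oRow0 (Function.update p f 0) (Function.update p f 1) ends o a₁ a₂ a₃ b +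
          p f * (prob (Function.update p f 1) (avoidAll ends a₂ {a₁}) *
            oRow1 (Function.update p f 0) (Function.update p f 1) ends o a₁ a₂ a₃ b)) :=
      mul_nonneg (mul_nonneg hq0 (sub_nonneg.2 hq1))
        (add_nonneg (mul_nonneg (sub_nonneg.2 hq1) h0) (mul_nonneg hq0 (mul_nonneg hZ1.le h1)))
    rw [← hid] at hrhs
    have hkey := (mul_nonneg_iff_of_pos_right hfac).1 hrhs
    linarith

omit [DecidableEq V] in
/-- **The converse at the given weight**: the `D`-chord along `f` gives the combination
`(1 − q)·oRow0 + q·Z₁·oRow1 ≥ 0` (for `0 < q < 1` and positive normalisers). -/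
theorem oRows_comb_of_nMixChord_D (hf : ends f = s(o, a₁)) (hq0 : 0 < p f) (hq1 : p f < 1)
    (hZ0 : 0 < prob (Function.update p f 0) (avoidAll ends a₂ {a₁}))
    (hZ1 : 0 < prob (Function.update p f 1) (avoidAll ends a₂ {a₁}))
    (hD0 : 0 < prob (Function.update p f 0) (PDEvent ends a₁ a₂ a₃))
    (hm : NMixChord (normD ends a₁ a₂ a₃) p ends o a₁ a₂ a₃ b f) :
    0 ≤ (1 - p f) * oRow0 (Function.update p f 0) (Function.update p f 1) ends o a₁ a₂ a₃ b +
      p f * (prob (Function.update p f 1) (avoidAll ends a₂ {a₁}) *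
        oRow1 (Function.update p f 0) (Function.update p f 1) ends o a₁ a₂ a₃ b) := by
  have hG1 : Gc (Function.update p f 1) ends o a₁ a₂ a₃ b = 0 :=
    Gc_eq_zero_of_sure_conn_o _ ends o a₃ b (conn_a1_o_of_update_one p ends hf)
  have hid := oRows_identity p ends (a₂ := a₂) (a₃ := a₃) b hf
  unfold NMixChord normD at hm
  rw [hG1, mul_zero, sub_zero] at hm
  have hfac : 0 < prob (Function.update p f 0) (avoidAll ends a₂ {a₁}) *
      prob (Function.update p f 1) (avoidAll ends a₂ {a₁}) *
      prob (Function.update p f 0) (PDEvent ends a₁ a₂ a₃) := mul_pos (mul_pos hZ0 hZ1) hD0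
  have hlhs : 0 ≤ (Gc p ends o a₁ a₂ a₃ b * prob (Function.update p f 0) (PDEvent ends a₁ a₂ a₃) -
      (1 - p f) * Gc (Function.update p f 0) ends o a₁ a₂ a₃ b * prob p (PDEvent ends a₁ a₂ a₃)) *
      (prob (Function.update p f 0) (avoidAll ends a₂ {a₁}) *
        prob (Function.update p f 1) (avoidAll ends a₂ {a₁}) *
        prob (Function.update p f 0) (PDEvent ends a₁ a₂ a₃)) :=
    mul_nonneg (by linarith) hfac.le
  rw [hid] at hlhs
  have hq : 0 < p f * (1 - p f) := mul_pos hq0 (sub_pos.2 hq1)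
  exact (mul_nonneg_iff_of_pos_left hq).1 hlhs

end Identity

end Mix

end Summit.Ventures.PercRepro2
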